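/-
Copyright: cell gate-hubbard-kl, typer seat t6 (D-0069 (2) B1 statement-typer wave). Statement-level skeleton of a
published text; nothing here is a claim about the Hubbard model or about superconductivity.
-/
import Mathlib
import Literature.MathematicalPhysics.QuantumLattice.FermiRG.DR2000PartIModel
import HarnessLib

/-!
# Disertori–Rivasseau 2000, Part I — §II.4.3, §III, §IV, App. A: convergent attributions (Theorems 1, 2), clustering tree
structures (Lemma 3), the Gram/sector/spatial-decay lemmas (Lemmas 4, 6, 8, 11, 12)

M. Disertori, V. Rivasseau, CMP **215** (2000) 251–290, arXiv:cond-mat/9907130 [DisertoriRivasseau2000]; render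
`paper:arxiv-cond-mat_9907130` (LOCATOR `pNNNN:Lm` = chunk:line of the corpus-TeX render, not a printed page).  Companion of
`FermiRG/DR2000PartIModel.lean` (model, cutoffs, Lemmas 1–2).  Cell rows: DR1.T1 = F-041, DR1.T2 = F-043 (REQUIRED);
DR1.L3 = F-042, L4 = F-044, L6 = F-046, L8 = F-048, L11 = F-051, L12 = F-052 (optional).  ISOTROPIC JELLIUM, `d = 2`, `T ≥ 0`;
nothing is transplanted to a lattice model.

WHAT IS PRINTED (render).  §II.4.3 p0006:L76–80 «We call an attribution μ convergent if it satisfies |eg_k| ≥ 6 for any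
k > 1»; L82–93 the convergent part `Γ^{ΛΛ₀}_{2p,conv}(φ^{Λ_T}_1,…,φ^{Λ_T}_{2p})` = the tree expansion (II.27) with the
loop-determinant sum restricted to convergent attributions.  **Theorem 1** p0006:L104–110 «For fixed Λ₀
and T ≥ 0, the limit Λ → 0 of the function Γ^{ΛΛ₀}_{2p,conv}(φ^{Λ_T}_1,…,φ^{Λ_T}_{2p}) exists and is analytic in λ for any
|λ| ≤ c where c is the convergence radius.»; L100–102 «The full theorem on the Fermi liquid, which includes renormalization
and requires a finite temperature cutoff is postponed to … (Part II)»; L114–116: the three-dimensional analogue is expected by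
the authors «but [we] have no proof until now» (not typed).  §III.2 p0007:L141–146 «Definition A clustering Tree Structure CTS is an unlabeled
rooted tree, with 2n−2 lines and 2n−1 vertices of two different types: n−1 crosses and n dots, such that the root is a cross
with coordination 2, each other cross has coordination 3 and each dot coordination 1»; **Lemma 3** p0007:L150 «The number of
CTS at order n is at most 3^{n−1}.»  §IV p0012:L3–37 (IV.1): absolute values inside all sums/integrals of (III.16);
**Theorem 2** p0012:L41–89 «Let ε > 0, Λ₀ = 1 and T ≥ 0 be fixed. The series (IV.1) is absolutely convergent for |λ| ≤ c,
c small enough. This convergence is uniform in Λ, then the IR limit Γ^{Λ₀}_{2p,conv} = lim_{Λ→0} Γ^{ΛΛ₀}_{2p,conv} exists and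
satisfies the bound: |Γ^{Λ₀}_{2p>4,conv}(φ^{Λ_T}_1,…,φ^{Λ_T}_{2p})| ≤ K₀ ‖φ₁‖_{L₁} ∏_{i=2}^{2p}‖φ̂_i‖_∞ T^{(7/4)2p − 1/2}
(1/(2p−4)) [K₁(ε)]^p (p!)² K(c) e^{−(1−ε)Λ_T^{1/s} d_𝒯^{1/s}(Ω₁,…,Ω_{2p})};  |Γ^{Λ₀}_{4,conv}| ≤ K₀' ‖φ₁‖_{L₁}∏_{i=2}^{4}‖φ̂_i‖_∞
T^{13/2}|log T| K(c) e^{−(1−ε)…};  |Γ^{Λ₀}_{2,conv}| ≤ K₀'' ‖φ₁‖_{L₁}‖φ̂₂‖_∞ T² K(c) e^{−(1−ε)…}, where Ω_i is the compact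
support of φ_i, K₁(ε) is a constant dependent from ε, K(c) is a function of c that tends to zero when c tends to zero, and
s is the Gevrey index of our cutoff function u (we assume that 1 < s < 2). … d_𝒯(Ω₁,…,Ω_{2p}) := inf_{x_i∈Ω_i} d_𝒯(x₁,…,x_{2p}),
d_𝒯(x₁,…,x_{2p}) := inf_{u−𝒯} Σ_{l∈𝒯} |x̄_l − x_l|, … the infimum over u−𝒯 is taken over all unordered trees (with any number
of vertices) connecting x₁,…,x_{2p}.»  The exponent of T for 2p > 4 renders as «T^742p -122p-4»; it is read
`T^{(7/4)·2p − 1/2}·(2p−4)^{−1}` from (IV.43) p0015:L158–159 / p0016:L65 «w_T^{7p/4 − 1/4}/(2p−4)» with w_T = Λ_T² = 2π²T²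
(p0014:L123) and from Part II Theorem 3 «T^{7p/2 − 1/2}/(2p−4)».  §IV.1 **Lemma 4** p0012:L98–110 (Gram inequality
|det M'(C)| ≤ ∏_f‖F_f‖_C ∏_g‖G_g‖_C with u_C^a = u(r/Λ²(w_{M})) − u(r/Λ²(w_{A(m)}))) and (IV.7)–(IV.13): ‖F_f‖²_C =
(2π)^{−2}∫d³k χ²/(k₀²+e²)^{1/2}[u(r/Λ_M²) − u(r/Λ_m²)] ≤ K Λ_M^{1/2}(Λ_M − Λ_m) (using |S| ≤ βΛ^{1/2}(w_M)Λα^{−1}).  §IV.3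
**Lemma 6** p0014:L1–32 (sector counting, proof App. B): sectors Σ_i = (α^{−1/4}, θ_i^s), i = 1..l, l ≥ 2, θ₁^s fixed,
θ_i^s ∈ Ω_i intervals of the Fermi surface with |Ω_i| > α^{−1/4}; Υ({θ_i^s}) = 0 unless ∃ k⃗₁..k⃗_l with Σk⃗_i = 0,
||k⃗_i| − 1| ≤ 1/√α, |θ_i − θ_i^s| ≤ α^{−1/4}; then ∏_{i=2}^{l}[(4/3)α^{1/4}∫_{Ω_i}dθ_i^s] Υ ≤ K^l ∏_{i∈I}|Ω_i|/α^{−1/4},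
I = the l−3 largest among Ω₂..Ω_l if l ≥ 4, I = ∅ if l = 2.  §IV.4 (IV.40)–(IV.42) p0015:L76–106 and **Lemma 8**
p0015:L126–128 «For any subgraph g_i (i ≠ r) we have x_i ≥ |et_i|/72 > 0» (x_i = (1/8)(|eg_i|−4) if 4 ≤ |eg_i| ≤ 10,
x_i ≥ (1/8)(|eg_i|−8) if |eg_i| > 10; convergent ⇒ |eg_i| ≥ 6; |et_i| ≤ |eg_i|).  App. A **Lemma 11** p0016:L99–111:
f ∈ C^∞(ℝ^d), f̂ of compact support of volume V_f with ‖∂^{n}f̂‖_∞ ≤ A₀∏_i[α_i^{n_i}C^{n_i}(n_i!)^s] (s ≥ 1) ⇒ |f(x)| ≤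
K A₀ V_f e^{−aΣ_i|x_i/α_i|^{1/s}} «for some constants K, μ and a» (proof: f(x) = ∫e^{−ipx}f̂, a = sμ^{1/s});
**Lemma 12** p0016:L134 «C₀^{w_q} satisfies (IV.21)», (IV.21) p0013:L80–89 = (A.1) p0016:L88–97: |C₀^{w_q}(δx, θ_{h_q,1})| ≤
K (Λ₀²−Λ²)/Λ⁴(w_q) Λ^{1/2}(w_q)Λ³(w_q) e^{−a[|δx₀Λ(w_q)|^{1/s} + |δx_rΛ(w_q)|^{1/s} + |δx_tΛ^{1/2}(w_q)|^{1/s}]}, x_r, x_t radial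
/ tangential to the sector centre, sector of size α_q^{−1/4} = Λ^{1/2}(w_q) (j_{h_q,1} = q).  **Lemma 5** p0013:L31–36 «η_{θ_{e₁,1}}(z)
decays as: |η_{θ_{e₁,1}}(z)| ≤ K Σ_m Λ_T^{5/2}/[1 + Λ_T²|z₀ + 2mβ|² + Λ_T²|z_r|² + Λ_T|z_t|²]² where z_r and z_t are the radial and
tangential components of z⃗ relative to the sector center», η̂_θ(k) = χ_θ(θ)·u(r/Λ_T²) ((IV.19) p0013:L27–29), sector of size
α₀^{−1/4} = Λ_T^{1/2} — typed in rev 2 as `Lemma5RootTestFunctionDecay` WITH THE SHIFTS `m/T`: the printed «2mβ» (also «2m/T» in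
(IV.20) p0013:L70–72, followed by «we performed the change of variable z₀ + m/T → z₀», L77–78) contradicts Lemma 1 (II.9) (images at
`x₀ + m/T`) and is false as it stands when Λ_T/T is large (|η_θ| is β-periodic in z₀, the even-shift majorant is not: at
z = (β, 0⃗) the left side is ≍ Λ_T^{5/2} while the right side is O(Λ_T^{5/2}(Λ_Tβ)^{−4})); with all shifts `mβ = m/T` it is
what the printed proof (decay of η⁰ + (II.9)) yields — MIS-STATEMENT recorded, ref-2 to rule.  Not typed: Lemma 7 (p0014:L67, a cost statement internal
to the proof's bookkeeping), Lemmas 9–10 (p0015:L211, p0016:L12: identities on CTS labellings, need the labelled-tree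
apparatus of §III.2.1).

WHAT IS TYPED, AND HOW.  * `PlaneCTS` = ordered full binary trees (dots = leaves, crosses = internal nodes); «unlabeled»
= up to the child-swap equivalence `PlaneCTS.Equiv`; **Lemma 3** = `Lemma3CTSCount`: a set of ≤ 3^{n−1} representatives
meets every class of order n (equivalent to the class count; no quotient needed).  * Test functions are `T = 0` functions
on `Mom = ℝ × ℝ²` (p0004:L80–82 «introduce them at T = 0»), `IsTestFn` = smooth with compact support, `l1Norm`, `hat` (the
transform `∫e^{−ikx}φ`, convention (II.4)), `supNorm`; the tree distance `treeDist`/`treeDistSets` is (IV.3) with the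
infimum over finite connected graphs through extra points (= over trees) and the Euclidean length on `ℝ³`.  * The vertex
functions are NOT constructed: `ConvergentPartData` records `Γ^{ΛΛ₀}_{2p,conv}` (Λ₀ = 1, one temperature) and the order-n
terms A_n of (IV.1) as data, with (IV.1) itself (`0 ≤ A_n`, `|Γ| ≤ Σ|λ|ⁿA_n` when summable) as fields; **Theorem 1** and
**Theorem 2** are the PREDICATES `Thm1Shape`, `Thm2Shape` on such data — hypothesis shapes for consumers, NOT asserted,
no `def … : Prop` debt (the closed facts need the CTS/class expansion (III.16) as a Lean object: cell GAP-LEDGER).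
Quantifiers: Thm 1 literal (∃ c; limit on the closed disc |λ| ≤ c; analytic = `DifferentiableOn ℂ` on the open disc);
Thm 2 over a family `T ↦ data`: the constants K₀, K₀', K₀'', K₁(ε), K(·) and the radius («c < 1/K₂», p0016:L80) precede
`∀ T ≥ 0` — the print fixes T first but names only the ε- and c-dependences, and the explicit powers of T are void
otherwise; «uniform in Λ» = uniformly small tails on Λ ∈ (0,1]; Λ_T after the limit = `lambdaT 0 T = √2πT`; the exponent
carries no Gevrey constant a (as printed in (IV.2); (IV.23) has it).  * **Lemma 4** = `Lemma4SectorSliceNorm`, the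
DR-specific bound (IV.11) on ‖F_f‖²_C (the abstract Gram inequality is the tree's `norm_det_momentumKernel_le`, module
`GramDeterminantBound`, CITED).  * **Lemma 6** = `Lemma6SectorCounting` (closed; «I = the l−3 largest» ⇔ «some I with
|I| = l−3» because every factor |Ω_i|α^{1/4} exceeds 1; arcs |Ω_i| ≤ 2π made explicit; l = 2 or l ≥ 4 as printed).
* **Lemma 8** is PROVED in the arithmetic form the printed proof establishes (`lemma8_exponent_lower_bound`).  * **Lemma 11**
= `Lemma11GevreyDecay` (closed; mixed partials `mixedPartial`; K, a depend on d, s, C only, as in the proof).  * **Lemma 12**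
= `Lemma12TreeLineDecay` (closed, T = 0 kernel of `treeLineSymbol × sectorChi`, α_q = Λ(w_q)^{−2}).  * **Lemma 5** (rev 2) =
`Lemma5RootTestFunctionDecay` over `etaSymbol` (IV.19), shifts `m/T` (see above).

LOCATOR ERRATUM (rev 2): the first landing (p414725) printed some chunk:line locators with the line offset of a concatenated
two-chunk view (p0006 +141, p0010/p0011, p0013 +237); corrected here together with the new row DR1.L5; statements unchanged.

DIVERGENCES.  (i) Theorems 1–2 are shapes on abstract data (above).  (ii) `supNorm` is `⨆` (junk 0 if unbounded; test
functions are C_c^∞ so φ̂ is bounded).  (iii) d_𝒯 uses the Euclidean norm on ℝ³ (the print's |·| is unspecified).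
(iv) Lemma 6's Υ uses sector membership «|θ_i − θ_i^s| ≤ α^{−1/4}» as printed in the Lemma (twice the support half-width).
-/

noncomputable section

open MeasureTheory Complex Filter
open scoped Topology BigOperators

namespace Literature.MathematicalPhysics.QuantumLattice.FermiRG.DR2000

open Literature.MathematicalPhysics.QuantumLattice

/-! ## §III.2 Clustering tree structures and Lemma 3 (row DR1.L3, F-042) -/

/-- Ordered (plane) representatives of clustering tree structures: a `dot` (coordination 1) or a `cross` with its two
subtrees; order = number of dots; a CTS of order n ≥ 2 has n − 1 crosses, the root cross having coordination 2.
[cite: DisertoriRivasseau2000, §III.2 Definition p0007:L141–146] -/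
inductive PlaneCTS : Type
  | dot : PlaneCTS
  | cross : PlaneCTS → PlaneCTS → PlaneCTS
  deriving DecidableEq

namespace PlaneCTS

/-- The order (number of dots). [cite: DisertoriRivasseau2000, §III.2 Definition p0007:L141–146] -/
def dots : PlaneCTS → ℕ
  | dot => 1
  | cross l r => dots l + dots r

/-- «unlabeled»: two plane representatives give the same CTS iff they agree up to swapping the two subtrees above any
cross. [cite: DisertoriRivasseau2000, §III.2 Definition p0007:L141–146] -/
def Equiv : PlaneCTS → PlaneCTS → Prop
  | dot, dot => True
  | cross l r, cross l' r' => (Equiv l l' ∧ Equiv r r') ∨ (Equiv l r' ∧ Equiv r l')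
  | dot, cross _ _ => False
  | cross _ _, dot => False

end PlaneCTS

/-- **Lemma 3**: «The number of CTS at order n is at most 3^{n−1}» — typed as: some set of at most `3^{n−1}` plane
representatives meets every swap-equivalence class of order `n`.  Named fact, not asserted.
[cite: DisertoriRivasseau2000, §III.2 Lemma 3 p0007:L150–158] -/
def Lemma3CTSCount : Prop :=
  ∀ n : ℕ, 1 ≤ n → ∃ S : Finset PlaneCTS, S.card ≤ 3 ^ (n - 1) ∧
    ∀ t : PlaneCTS, t.dots = n → ∃ s ∈ S, PlaneCTS.Equiv t s

/-! ## Test functions, norms and the tree distance of (IV.3) -/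

/-- Test functions: functions on `ℝ × ℝ²` «introduced at T = 0» (p0004:L80–82). [cite: DisertoriRivasseau2000, §II.3 p0004:L76–82] -/
abbrev TestFn : Type := Mom → ℂ

/-- Admissible test functions: smooth with compact support Ω («smooth test functions … L_∞ and L₁ in position space»,
«Ω_i is the compact support of φ_i»). [cite: DisertoriRivasseau2000, §II.3 p0004:L76–80, Thm 2 p0012:L76] -/
def IsTestFn (φ : TestFn) : Prop := ContDiff ℝ ((⊤ : ℕ∞) : WithTop ℕ∞) φ ∧ HasCompactSupport φ

/-- `‖φ‖_{L₁} = ∫d³x |φ(x)|`. [cite: DisertoriRivasseau2000, §IV Thm 2 (IV.2) p0012:L51] -/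
def l1Norm (φ : TestFn) : ℝ := ∫ x : Mom, ‖φ x‖

/-- The Fourier transform `φ̂(k) = ∫d³x e^{−ikx} φ(x)`, `kx = −k₀x₀ + k⃗·x⃗` (convention (II.4) at T = 0).
[cite: DisertoriRivasseau2000, §II.1 (II.4) p0003:L52–54] -/
def hat (φ : TestFn) (k : Mom) : ℂ := ∫ x : Mom, Complex.exp (-((pairing k x : ℂ) * Complex.I)) * φ x

/-- The sup norm `‖f‖_∞` (as `⨆`; junk `0` for unbounded `f`). [cite: DisertoriRivasseau2000, §IV Thm 2 (IV.2) p0012:L52] -/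
def supNorm (f : Mom → ℂ) : ℝ := ⨆ k : Mom, ‖f k‖

/-- `‖φ₁‖_{L₁} ∏_{i=2}^{2p} ‖φ̂_i‖_∞` (index `0` is the root test function φ₁). [cite: DisertoriRivasseau2000, §IV Thm 2 (IV.2) p0012:L51–52] -/
def testNormProduct {m : ℕ} (φ : Fin m → TestFn) : ℝ :=
  ∏ i : Fin m, if (i : ℕ) = 0 then l1Norm (φ i) else supNorm (hat (φ i))

/-- Euclidean length on `ℝ × ℝ²`. [cite: DisertoriRivasseau2000, §IV (IV.3) p0012:L84–85] -/
def enorm3 (x : Mom) : ℝ := Real.sqrt (x.1 ^ 2 + x.2 0 ^ 2 + x.2 1 ^ 2)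

open Classical in
/-- The length `Σ_{l∈𝒯}|x̄_l − x_l|` of a finite graph with vertex positions `pos`. [cite: DisertoriRivasseau2000, §IV (IV.3) p0012:L84–85] -/
def graphLength {ι : Type*} [Fintype ι] (pos : ι → Mom) (G : SimpleGraph ι) : ℝ :=
  (∑ a : ι, ∑ b : ι, if G.Adj a b then enorm3 (pos a - pos b) else 0) / 2

/-- The tree distance `d_𝒯(x₁,…,x_m)`: infimum over «all unordered trees (with any number of vertices) connecting
x₁,…,x_m» of the total length — here over finite connected graphs through `k` extra points (same infimum).
[cite: DisertoriRivasseau2000, §IV (IV.3) p0012:L84–89] -/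
def treeDist {m : ℕ} (x : Fin m → Mom) : ℝ :=
  sInf {L : ℝ | ∃ (k : ℕ) (y : Fin k → Mom) (G : SimpleGraph (Fin m ⊕ Fin k)), G.Connected ∧ L = graphLength (Sum.elim x y) G}

/-- `d_𝒯(Ω₁,…,Ω_m) := inf_{x_i ∈ Ω_i} d_𝒯(x₁,…,x_m)`. [cite: DisertoriRivasseau2000, §IV (IV.3) p0012:L81–82] -/
def treeDistSets {m : ℕ} (Ω : Fin m → Set Mom) : ℝ :=
  sInf {d : ℝ | ∃ x : Fin m → Mom, (∀ i, x i ∈ Ω i) ∧ d = treeDist x}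

/-! ## §II.4.3 / §IV: the convergent part of the vertex functions as data; Theorems 1 and 2 as hypothesis shapes -/

/-- The convergent part of the theory as DATA (not constructed here): `gammaConv p Λ λ φ` stands for
`Γ^{ΛΛ₀}_{2p,conv}(φ^{Λ_T}_1,…,φ^{Λ_T}_{2p})` of (II.29)/(III.16) at `Λ₀ = 1` and one fixed temperature, and
`absTerm p Λ φ n` for the order-n term `A_n` of the majorant series (IV.1) (coefficient of `|λ|ⁿ`, the `1/n!` included);
the two fields are (IV.1) itself («We insert absolute values inside the sums and integrals and obtain the inequality»).
[cite: DisertoriRivasseau2000, §II.4.3 (II.29) p0006:L82–93, §IV (IV.1) p0012:L3–37] -/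
structure ConvergentPartData where
  /-- `Γ^{ΛΛ₀}_{2p,conv}` smeared with `2p` test functions, as a function of `(p, Λ, λ, φ)`. -/
  gammaConv : (p : ℕ) → ℝ → ℂ → (Fin (2 * p) → TestFn) → ℂ
  /-- the order-`n` term of (IV.1). -/
  absTerm : (p : ℕ) → ℝ → (Fin (2 * p) → TestFn) → ℕ → ℝ
  absTerm_nonneg : ∀ (p : ℕ) (Λ : ℝ) (φ : Fin (2 * p) → TestFn) (n : ℕ), 0 ≤ absTerm p Λ φ n
  norm_gammaConv_le : ∀ (p : ℕ) (Λ : ℝ) (lam : ℂ) (φ : Fin (2 * p) → TestFn),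
    Summable (fun n : ℕ => ‖lam‖ ^ n * absTerm p Λ φ n) →
      ‖gammaConv p Λ lam φ‖ ≤ ∑' n : ℕ, ‖lam‖ ^ n * absTerm p Λ φ n

/-- **Theorem 1 (shape)** on convergent-part data: «For fixed Λ₀ and T ≥ 0, the limit Λ → 0 of Γ^{ΛΛ₀}_{2p,conv}(φ^{Λ_T}_1,
…,φ^{Λ_T}_{2p}) exists and is analytic in λ for any |λ| ≤ c where c is the convergence radius» — ∃ c > 0 such that for
all 2p ≥ 2 admissible test functions the limit exists for every |λ| ≤ c and is holomorphic on the open disc.  The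
CONVERGENT part only (two- and four-point insertions removed); «the full theorem … is postponed to (Part II)»; the d = 3
analogue is printed without proof (p0006:L114–116) and is not typed.  Predicate, NOT asserted. [cite: DisertoriRivasseau2000, §II.4.3 Theorem 1 p0006:L104–116] -/
def Thm1Shape (D : ConvergentPartData) : Prop :=
  ∃ c : ℝ, 0 < c ∧ ∀ (p : ℕ), 1 ≤ p → ∀ φ : Fin (2 * p) → TestFn, (∀ i, IsTestFn (φ i)) →
    ∃ G : ℂ → ℂ, DifferentiableOn ℂ G (Metric.ball 0 c) ∧
      ∀ lam : ℂ, ‖lam‖ ≤ c → Tendsto (fun Λ : ℝ => D.gammaConv p Λ lam φ) (𝓝[>] 0) (𝓝 (G lam))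

/-- «absolutely convergent for |λ| ≤ c … uniform in Λ»: summable at radius `c` for every `Λ ∈ (0,1]`, with tails small
uniformly in `Λ`. [cite: DisertoriRivasseau2000, §IV Theorem 2 p0012:L42–45] -/
def UnifAbsConv (a : ℝ → ℕ → ℝ) (c : ℝ) : Prop :=
  (∀ Λ : ℝ, 0 < Λ → Λ ≤ 1 → Summable (fun n : ℕ => c ^ n * a Λ n)) ∧
    ∀ δ : ℝ, 0 < δ → ∃ N : ℕ, ∀ Λ : ℝ, 0 < Λ → Λ ≤ 1 → ∑' n : ℕ, c ^ (n + N) * a Λ (n + N) < δ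

/-- The printed right-hand sides of (IV.2) for `2p` external legs (`p = 1, 2`, and `2p > 4`), with `Λ_T = √2πT` after
the limit and `Kc = K(c)`. [cite: DisertoriRivasseau2000, §IV Theorem 2 (IV.2) p0012:L48–80] -/
def thm2Bound (T s ε K₀ K₀' K₀'' K₁ Kc : ℝ) (p : ℕ) (φ : Fin (2 * p) → TestFn) : ℝ :=
  if p = 1 then K₀'' * testNormProduct φ * T ^ 2 * Kc *
      Real.exp (-(1 - ε) * lambdaT 0 T ^ (1 / s) * treeDistSets (fun i => tsupport (φ i)) ^ (1 / s))
  else if p = 2 then K₀' * testNormProduct φ * T ^ ((13 : ℝ) / 2) * |Real.log T| * Kc *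
      Real.exp (-(1 - ε) * lambdaT 0 T ^ (1 / s) * treeDistSets (fun i => tsupport (φ i)) ^ (1 / s))
  else K₀ * testNormProduct φ * T ^ ((7 : ℝ) / 4 * (2 * p) - 1 / 2) * (1 / (2 * (p : ℝ) - 4)) * K₁ ^ p *
      ((Nat.factorial p : ℕ) : ℝ) ^ 2 * Kc *
      Real.exp (-(1 - ε) * lambdaT 0 T ^ (1 / s) * treeDistSets (fun i => tsupport (φ i)) ^ (1 / s))

/-- **Theorem 2 (shape)** on a family `T ↦` convergent-part data (Λ₀ = 1, Gevrey index `s ∈ (1,2)` of `u`): for every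
ε > 0 there are constants K₀, K₀', K₀'' > 0, K₁ = K₁(ε) > 0, a function K(c) → 0 (c → 0⁺) and a radius c₀ > 0 such that for
every T ≥ 0, every 0 < c ≤ c₀ and all admissible test functions: the series (IV.1) converges at radius c uniformly in
Λ ∈ (0,1], and for |λ| ≤ c the IR limit exists and obeys (IV.2) (`thm2Bound`).  Predicate, NOT asserted; see the module
docstring for the quantifier reading. [cite: DisertoriRivasseau2000, §IV Theorem 2 (IV.2)–(IV.3) p0012:L41–89] -/
def Thm2Shape (s : ℝ) (D : ℝ → ConvergentPartData) : Prop :=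
  ∀ ε : ℝ, 0 < ε →
    ∃ (K₀ K₀' K₀'' K₁ c₀ : ℝ) (Kc : ℝ → ℝ), 0 < K₀ ∧ 0 < K₀' ∧ 0 < K₀'' ∧ 0 < K₁ ∧ 0 < c₀ ∧
      Tendsto Kc (𝓝[>] 0) (𝓝 0) ∧
      ∀ T : ℝ, 0 ≤ T → ∀ c : ℝ, 0 < c → c ≤ c₀ →
        ∀ (p : ℕ), 1 ≤ p → ∀ φ : Fin (2 * p) → TestFn, (∀ i, IsTestFn (φ i)) →
          UnifAbsConv (fun Λ n => (D T).absTerm p Λ φ n) c ∧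
          ∀ lam : ℂ, ‖lam‖ ≤ c →
            ∃ G : ℂ, Tendsto (fun Λ : ℝ => (D T).gammaConv p Λ lam φ) (𝓝[>] 0) (𝓝 G) ∧
              ‖G‖ ≤ thm2Bound T s ε K₀ K₀' K₀'' K₁ (Kc c) p φ

/-! ## §IV.1 Lemma 4: the norms entering the Gram bound (row DR1.L4, F-044) -/

/-- **Lemma 4**, DR-specific half: the squared norm (IV.11) of the Gram vectors of a loop field whose bands run from
`Λ_m = Λ(w_{𝒜(m(f,𝒞))})` to `Λ_M = Λ(w_{M(f,𝒞)})` and whose sector has size `Λ_M^{1/2}` obeys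
`(2π)^{−2}∫d³k χ(θ)²(k₀²+e²)^{−1/2}[u(r/Λ_M²) − u(r/Λ_m²)] ≤ K Λ_M^{1/2}(Λ_M − Λ_m)` (∫d³k = TΣ_{k₀}∫d²k), uniformly in the
sector centre, for scales above the temperature (`√2πT ≤ Λ_m`, used in |S| ≤ βΛ^{1/2}Λα^{−1}).  The Gram inequality
|det M'| ≤ ∏‖F_f‖∏‖G_g‖ itself is the tree's `norm_det_momentumKernel_le` (module `GramDeterminantBound`).  Named fact,
not asserted. [cite: DisertoriRivasseau2000, §IV.1 Lemma 4 (IV.4)–(IV.13) p0012:L98–110, p0012:L157–208] -/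
def Lemma4SectorSliceNorm : Prop :=
  ∀ u : ℝ → ℝ, IsCutoff u → ∃ K : ℝ, 0 < K ∧
    ∀ (T Λm ΛM θs : ℝ), 0 < T → Real.sqrt 2 * Real.pi * T ≤ Λm → Λm ≤ ΛM → ΛM ≤ 1 →
      (T / (2 * Real.pi) ^ 2) * ∑' n : ℤ, ∫ k : Fin 2 → ℝ,
          sectorChiMom u (1 / ΛM ^ 2) θs k ^ 2 / Real.sqrt (rOf (matsubaraMom T n k)) *
            bandCutoff u Λm ΛM (rOf (matsubaraMom T n k))
        ≤ K * ΛM ^ (1 / 2 : ℝ) * (ΛM - Λm)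

/-! ## §IV.3 Lemma 6: the sector counting lemma (row DR1.L6, F-046; DECOMP F.0) -/

/-- Momentum conservation is compatible with the sectors `(α^{−1/4}, θ_i^s)`: «there exist some set of momenta
k⃗₁,…,k⃗_l satisfying Σ_i k⃗_i = 0; ||k⃗_i| − 1| ≤ 1/√α ∀i; k⃗_i ∈ Σ_i ∀i (… |θ_i − θ_i^s| ≤ α^{−1/4})».
[cite: DisertoriRivasseau2000, §IV.3 Lemma 6 p0014:L9–20] -/
def MomentaCompatible (α : ℝ) {l : ℕ} (θs : Fin l → ℝ) : Prop :=
  ∃ k : Fin l → (Fin 2 → ℝ), (∑ i, k i = 0) ∧ ∀ i,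
    |Real.sqrt (k i 0 ^ 2 + k i 1 ^ 2) - 1| ≤ 1 / Real.sqrt α ∧
      ∃ n : ℤ, |polarAngle (k i) - θs i - 2 * Real.pi * n| ≤ α ^ (-(1 / 4 : ℝ))

open Classical in
/-- The function `Υ({θ_i^s})` of Lemma 6 (1 if the sectors are permitted by momentum conservation, 0 otherwise).
[cite: DisertoriRivasseau2000, §IV.3 Lemma 6 p0014:L9–20] -/
def upsilon (α : ℝ) {l : ℕ} (θs : Fin l → ℝ) : ℝ := if MomentaCompatible α θs then 1 else 0

/-- **Lemma 6 (sector counting)**: there is `K` such that for all `α ≥ 1`, all `l = l'+1` sectors with `l = 2` or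
`l ≥ 4`, θ₁^s fixed and the other centres integrated over arcs `Ω_i = [a_i, b_i]` of the Fermi circle with
`α^{−1/4} < |Ω_i| ≤ 2π`: `∏_{i≥2}[(4/3)α^{1/4}∫_{Ω_i}dθ_i^s] Υ ≤ K^l ∏_{i∈I}|Ω_i|α^{1/4}` for some `I` with `|I| = l − 3`
(equivalently, as printed, for `I` = the l−3 largest arcs; `I = ∅` when `l = 2`).  Named fact, not asserted.
[cite: DisertoriRivasseau2000, §IV.3 Lemma 6 (IV.31) p0014:L1–38, App. B p0017:L27–p0018] -/
def Lemma6SectorCounting : Prop :=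
  ∃ K : ℝ, 0 < K ∧ ∀ (α : ℝ), 1 ≤ α → ∀ (l' : ℕ), (l' = 1 ∨ 3 ≤ l') →
    ∀ (θ₁ : ℝ) (a b : Fin l' → ℝ), (∀ i, α ^ (-(1 / 4 : ℝ)) < b i - a i ∧ b i - a i ≤ 2 * Real.pi) →
      ∃ I : Finset (Fin l'), I.card = l' - 2 ∧
        ((4 / 3) * α ^ (1 / 4 : ℝ)) ^ l' *
            ∫ θ in Set.pi Set.univ (fun i => Set.Icc (a i) (b i)), upsilon α (Fin.cons θ₁ θ : Fin (l' + 1) → ℝ)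
          ≤ K ^ (l' + 1) * ∏ i ∈ I, ((b i - a i) * α ^ (1 / 4 : ℝ))

/-! ## §IV.4 Lemma 8 (row DR1.L8, F-048): PROVED in the arithmetic form of the printed proof -/

/-- **Lemma 8** «For any subgraph g_i (i ≠ r) we have x_i ≥ |et_i|/72 > 0», with the exponent `x_i` of (IV.40)–(IV.42):
`x_i = (|eg_i| − 4)/8` when `|eg_i| ≤ 10`, `x_i ≥ (|eg_i| − 8)/8` when `|eg_i| > 10`, for a convergent attribution
(`|eg_i| ≥ 6`) and `|et_i| ≤ |eg_i|` tree external lines.  Proved (cases `|eg_i| ≤ 10` / `> 10`, as printed).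
[cite: DisertoriRivasseau2000, §IV.4 Lemma 8 (IV.40)–(IV.42) p0015:L76–150] -/
theorem lemma8_exponent_lower_bound (eg et : ℕ) (x : ℝ) (h6 : 6 ≤ eg) (hle : et ≤ eg)
    (hx₁ : eg ≤ 10 → x = ((eg : ℝ) - 4) / 8) (hx₂ : 10 < eg → ((eg : ℝ) - 8) / 8 ≤ x) :
    (et : ℝ) / 72 ≤ x ∧ 0 < x := by
  have h6' : (6 : ℝ) ≤ eg := by exact_mod_cast h6
  have hle' : (et : ℝ) ≤ eg := by exact_mod_cast hle
  by_cases h : eg ≤ 10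
  · have h10 : (eg : ℝ) ≤ 10 := by exact_mod_cast h
    rw [hx₁ h]
    constructor <;> linarith
  · rw [not_le] at h
    have h11 : (11 : ℝ) ≤ eg := by exact_mod_cast h
    have hx := hx₂ h
    constructor <;> linarith

/-! ## Appendix A: Lemma 11 (Gevrey decay, row DR1.L11, F-051) and Lemma 12 (tree-line decay, row DR1.L12, F-052) -/

/-- `∂^n` along the coordinate `i` (iterated one-variable derivative of the section through `p`).
[cite: DisertoriRivasseau2000, App. A Lemma 11 (A.2) p0016:L102–105] -/
def partialPow {d : ℕ} (i : Fin d) (n : ℕ) (g : (Fin d → ℝ) → ℂ) : (Fin d → ℝ) → ℂ :=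
  fun p => iteratedDeriv n (fun t : ℝ => g (Function.update p i t)) (p i)

/-- The mixed partial `∂₁^{n₁}⋯∂_d^{n_d} g` (coordinates applied in order; for smooth `g` the order is immaterial).
[cite: DisertoriRivasseau2000, App. A Lemma 11 (A.2) p0016:L102–105] -/
def mixedPartial {d : ℕ} (n : Fin d → ℕ) (g : (Fin d → ℝ) → ℂ) : (Fin d → ℝ) → ℂ :=
  (List.finRange d).foldr (fun i h => partialPow i (n i) h) g

/-- **Lemma 11**: for `d`, `s ≥ 1`, `C > 0` there are `K, a > 0` such that for every `g = f̂ ∈ C_c^∞(ℝ^d)` (support of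
volume `V_f`), `A₀` and `α_i > 0` with `‖∂^{n}f̂‖_∞ ≤ A₀∏_i[α_i^{n_i}C^{n_i}(n_i!)^s]` for all multi-indices `n`, the function
`f(x) = ∫e^{−ipx}f̂(p)dp` obeys `|f(x)| ≤ K A₀ V_f e^{−aΣ_i|x_i/α_i|^{1/s}}` for all `x`.  Named fact, not asserted.
[cite: DisertoriRivasseau2000, App. A Lemma 11 (A.2)–(A.3) p0016:L99–132] -/
def Lemma11GevreyDecay : Prop :=
  ∀ (d : ℕ) (s C : ℝ), 1 ≤ s → 0 < C → ∃ (K a : ℝ), 0 < K ∧ 0 < a ∧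
    ∀ (g : (Fin d → ℝ) → ℂ) (A₀ : ℝ) (α : Fin d → ℝ),
      ContDiff ℝ ((⊤ : ℕ∞) : WithTop ℕ∞) g → HasCompactSupport g → (∀ i, 0 < α i) →
      (∀ (n : Fin d → ℕ) (p : Fin d → ℝ),
          ‖mixedPartial n g p‖ ≤ A₀ * ∏ i, (α i ^ (n i) * C ^ (n i) * ((Nat.factorial (n i) : ℕ) : ℝ) ^ s)) →
        ∀ x : Fin d → ℝ,
          ‖∫ p : Fin d → ℝ, Complex.exp (-((∑ i, p i * x i : ℝ) : ℂ) * Complex.I) * g p‖ ≤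
            K * A₀ * (volume (Function.support g)).toReal * Real.exp (-a * ∑ i, |x i / α i| ^ (1 / s))

/-- The `T = 0` sectorised tree-line propagator in position space, `C₀^{w_q}(δx, θ_s) = (2π)^{−3}∫d³k e^{ikδx} C^{w_q}(k)
χ^{θ_s}_{α_q}(θ(k⃗))` with `α_q^{−1/4} = Λ^{1/2}(w_q)` (i.e. `α_q = Λ(w_q)^{−2}`), at `Λ₀ = 1`.
[cite: DisertoriRivasseau2000, §III.4 (III.18) p0010:L116–119, App. A p0016:L88–97] -/
def treeLineKernel0 (u : ℝ → ℝ) (Λ Λw θs : ℝ) (x : Mom) : ℂ :=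
  zeroKernel (fun k => treeLineSymbol u Λ 1 Λw k * (sectorChiMom u (1 / Λw ^ 2) θs k.2 : ℂ)) x

/-- **Lemma 12** «C₀^{w_q} satisfies (IV.21)»: for a Gevrey cutoff `u` of class `s > 1` there are `K, a > 0` with
`|C₀^{w_q}(δx, θ_s)| ≤ K (1 − Λ²)/Λ⁴(w_q) · Λ^{1/2}(w_q)Λ³(w_q) · e^{−a[|δx₀Λ(w_q)|^{1/s} + |δx_rΛ(w_q)|^{1/s} + |δx_tΛ^{1/2}(w_q)|^{1/s}]}`
for all `0 ≤ Λ < Λ(w_q) ≤ 1`, sector centres `θ_s` and `δx`, `(δx_r, δx_t)` the radial/tangential components of `δx⃗`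
at `θ_s`.  Named fact, not asserted. [cite: DisertoriRivasseau2000, §IV.2.2 (IV.21) p0013:L80–104, App. A Lemma 12 p0016:L134–170, p0017:L1–26] -/
def Lemma12TreeLineDecay : Prop :=
  ∀ (u : ℝ → ℝ) (s A μ : ℝ), IsCutoff u → 1 < s → IsGevreyL1 s A μ u →
    ∃ (K a : ℝ), 0 < K ∧ 0 < a ∧ ∀ (Λ Λw θs : ℝ), 0 ≤ Λ → Λ < Λw → Λw ≤ 1 → ∀ x : Mom,
      ‖treeLineKernel0 u Λ Λw θs x‖ ≤
        K * ((1 - Λ ^ 2) / Λw ^ 4) * (Λw ^ (1 / 2 : ℝ) * Λw ^ 3) *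
          Real.exp (-a * (|x.1 * Λw| ^ (1 / s) +
            |(x.2 0 * Real.cos θs + x.2 1 * Real.sin θs) * Λw| ^ (1 / s) +
            |(-x.2 0 * Real.sin θs + x.2 1 * Real.cos θs) * Λw ^ (1 / 2 : ℝ)| ^ (1 / s)))

/-! ## §IV.2.1 Lemma 5 (row DR1.L5, F-045; rev 2): decay of the root test-function kernel `η_θ` -/

/-- `η̂_θ(k) = χ_θ(θ(k⃗))·u(r/Λ_T²)` — the momentum cutoff of the root test function, sector of size `α₀^{−1/4} = Λ_T^{1/2}`
(`α₀ = Λ_T^{−2}`). [cite: DisertoriRivasseau2000, §IV.2.1 (IV.19) p0013:L27–29] -/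
def etaSymbol (u : ℝ → ℝ) (Λ T θs : ℝ) (k : Mom) : ℂ :=
  ((sectorChiMom u (1 / lambdaT Λ T ^ 2) θs k.2 * u (rOf k / lambdaT Λ T ^ 2) : ℝ) : ℂ)

/-- **Lemma 5** (decay of `η_θ = ` the `T > 0` kernel of `η̂_θ`), typed with the image shifts `m/T` of Lemma 1 (II.9) in place
of the printed «2mβ» (see the module docstring: as printed the bound fails for large `Λ_T/T`; this is the statement the printed
proof gives): there is `K` (depending on `u` only) with
`|η_θ(z)| ≤ K Σ_{m∈ℤ} Λ_T^{5/2}/[1 + Λ_T²(z₀ + m/T)² + Λ_T² z_r² + Λ_T z_t²]²` for all `0 ≤ Λ ≤ 1`, `T > 0`, sector centres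
`θ` and `z = (z₀, z⃗)`, `z_r, z_t` the radial/tangential components of `z⃗` at `θ`, `Λ_T = max(Λ, √2πT)`.  Named fact, not
asserted; corrected form of a printed statement (ref-2 to rule). [cite: DisertoriRivasseau2000, §IV.2.1 Lemma 5 p0013:L31–61] -/
def Lemma5RootTestFunctionDecay : Prop :=
  ∀ u : ℝ → ℝ, IsCutoff u → ∃ K : ℝ, 0 < K ∧ ∀ (Λ T θs : ℝ), 0 ≤ Λ → Λ ≤ 1 → 0 < T → ∀ z : Mom,
    ‖thermalKernel T (etaSymbol u Λ T θs) z‖ ≤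
      K * ∑' m : ℤ, lambdaT Λ T ^ (5 / 2 : ℝ) /
        (1 + lambdaT Λ T ^ 2 * (z.1 + (m : ℝ) / T) ^ 2 +
          lambdaT Λ T ^ 2 * (z.2 0 * Real.cos θs + z.2 1 * Real.sin θs) ^ 2 +
          lambdaT Λ T * (-z.2 0 * Real.sin θs + z.2 1 * Real.cos θs) ^ 2) ^ 2

end Literature.MathematicalPhysics.QuantumLattice.FermiRG.DR2000

end
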